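import Literature.Geometry.Lorentzian.AFEndRestrict
import Literature.Geometry.Lorentzian.AsymptoticallyFlatCompleteness
import Literature.Geometry.Lorentzian.FinalState
import HarnessLib

/-!
# Admissibility only sees the data near infinity (plus the constraints)

A short support file (topic `Geometry/Lorentzian`; everything PROVED). Christodoulou admissibility
(`admissibleVacuumData X`: vacuum constraints, completeness, a sole strongly asymptotically flat
end of Dafermos–Rodnianski class) of a datum `D` passes to every VACUUM datum `D'` which agrees with
`D` off a compact set `K`:

* `mem_admissibleVacuumData_of_agree_off_compact` — the sole end `e` of `D` has far regions disjoint
  from `K` (`AFEnd.exists_forall_far_disjoint`), on which the sections of `D'` and `D` agree, so the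
  decay class transfers (`IsStronglyAsymptoticallyFlatDR.congr_of_eqOn_far`); the end is still the
  sole end; completeness of `D'` then follows from the structure at infinity alone
  (`isComplete_of_isSoleEnd_holds`: a one-ended asymptotically flat datum is complete).

This is the bookkeeping behind every compactly supported modification of admissible data (local
gluing, breathing deformations, conformal bumps solving the constraints).

## References

* D. Christodoulou, *On the global initial value problem and the issue of singularities*,
  CQG 16 (1999), p. A24. [Christodoulou1999]
* R. Bartnik, *The mass of an asymptotically flat manifold*, CPAM 39 (1986), §1. [Bartnik1986]
-/

noncomputable section

open Set Filter
open scoped Manifold ContDiff Topology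

namespace Literature.Geometry.Lorentzian

namespace InitialDataSet

variable {X : Type} [TopologicalSpace X] [ChartedSpace E3 X] [IsManifold (𝓡 3) ∞ X] [T2Space X]
  [SecondCountableTopology X] [ConnectedSpace X]

/-- **Admissibility passes to vacuum data agreeing with an admissible datum off a compact set.**
If `D ∈ admissibleVacuumData X`, `D'` solves the vacuum constraints, `K` is compact and
`(h', k') = (h, k)` at every point outside `K`, then `D' ∈ admissibleVacuumData X` (same sole end,
same mass). Christodoulou 1999, p. A24 (the class); Bartnik 1986, §1. [cite: Christodoulou1999, p. A24] -/
theorem mem_admissibleVacuumData_of_agree_off_compact {D D' : InitialDataSet (𝓡 3) X}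
    (hD : D ∈ admissibleVacuumData X)
    (hvac : ∀ [D'.metric.HasLeviCivita], D'.IsVacuumConstraintSolution)
    {K : Set X} (hK : IsCompact K)
    (hagree : ∀ x ∉ K, D'.h.inner x = D.h.inner x ∧ D'.k x = D.k x) :
    D' ∈ admissibleVacuumData X := by
  obtain ⟨-, e, M, hsole, hdecay⟩ := hD
  obtain ⟨R₀, hR₀⟩ := e.exists_forall_far_disjoint hK
  have hfar : ∀ q ∈ e.far R₀, q ∉ K := fun q hq hqK ↦
    Set.disjoint_left.1 (hR₀ R₀ le_rfl) hq hqK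
  have hdecay' : e.IsStronglyAsymptoticallyFlatDR D' M :=
    AFEnd.IsStronglyAsymptoticallyFlatDR.congr_of_eqOn_far (R₀ := R₀)
      (fun q hq ↦ (hagree q (hfar q hq)).1) (fun q hq ↦ (hagree q (hfar q hq)).2) hdecay
  refine ⟨?_, e, M, hsole, hdecay'⟩
  intro inst
  exact ⟨hvac, isComplete_of_isSoleEnd_holds X D' e M 1 2 2 1 zero_le_one hdecay' hsole⟩

/-- The same, with the agreement phrased as equality of sections on the complement of `K`. [cite: Christodoulou1999, p. A24] -/
theorem mem_admissibleVacuumData_of_eqOn_compl {D D' : InitialDataSet (𝓡 3) X}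
    (hD : D ∈ admissibleVacuumData X)
    (hvac : ∀ [D'.metric.HasLeviCivita], D'.IsVacuumConstraintSolution)
    {K : Set X} (hK : IsCompact K)
    (hh : ∀ x ∉ K, D'.h.inner x = D.h.inner x) (hk : ∀ x ∉ K, D'.k x = D.k x) :
    D' ∈ admissibleVacuumData X :=
  mem_admissibleVacuumData_of_agree_off_compact hD hvac hK fun x hx ↦ ⟨hh x hx, hk x hx⟩

end InitialDataSet

end Literature.Geometry.Lorentzian

end
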